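import Literature.Barriers.NavierStokesRegularity.NavierStokesInequalitySwirlCalculus
import Literature.Analysis.FluidPDE.AxisymmetricLiftR5
import Literature.Analysis.FluidPDE.IsometryInvariance
import HarnessLib

/-!
# Calculus of the fields `u[v,f]`, II: the Laplacian of the swirl (Lemma 3.1 (ii), (3.29)–(3.31))

Barrier catalogue support file for `NavierStokesRegularity` (D-0021), on the decomposition path
of `Literature.Barriers.NavierStokesRegularity.NSIBlock_of_arrangement` (fact D of
`NavierStokesInequalityArrangement`; Ożański, arXiv:1709.00602v4, §4). The verification of the
Navier–Stokes inequality in Proposition 4.2 ("Case 1", (4.32)) rests on the two properties of a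
structure `(v,f,φ)` on `U` printed after Definition 3.3: in `R({φ < 1})`,
(3.29) `u[v,f]·Δu[v,f] ≥ 0` and (3.30) `u[v,f]·∇q = 0` for every axisymmetric scalar `q`,
via (3.31) `u[v,f](x₁,x₂,0)·Δu[v,f](x₁,x₂,0) = f Lf ≥ 0` and Lemma 3.1 (ii):
`Δu[0,f] = (Lf) φ̂`, `Lf = Δf + x₂⁻¹∂₂f - x₂⁻²f` ((3.15)–(3.16)); "Case 2" ((4.35)) pairs
`u·∇(|u|² + 2p)` on `ℝ³` with the planar expression `(a₁v₁ + a₂v₂)·∇(…)` on `P` ((4.24),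
using (3.17), (3.22)). This file proves, for the tree's `swirlField v f`, `opL f`, meridian
coordinates `q = (r,z) = meridian x`:

* `laplacian_smul_clm` — Leibniz: `Δ(G·Lx) = (ΔG)·Lx + 2 L(∇G)` for a linear field `L`;
* `IsAxisymmetricScalar.laplacian_eq_planar` — **the cylindrical Laplacian of an axisymmetric
  scalar** off the axis: `ΔG = ∂ᵣ∂ᵣg + r⁻¹∂ᵣg + ∂_z∂_zg`, `g = G(·,0,·)` (rotate to the meridian
  plane; `x₀∂₁∂₁G = ∂₀G` there, `AxisymmetricLiftR5`);
* `gradient_comp_meridian` — `∇(γ∘meridian) = (∂ᵣγ) ρ̂ + (∂_zγ) x̂_axis`;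
* `laplacian_swirl` — **Lemma 3.1 (ii)**: `Δ(f∘meridian · φ̂)(x) = (Lf)(q) φ̂(x)` off the axis,
  hence `inner_swirl_laplacian_swirl`: `⟪f φ̂, Δ(f φ̂)⟫ = f Lf` ((3.31));
* `inner_swirlField_gradient` — **(3.30) generalised**: for an axisymmetric scalar `Q`
  differentiable at `x`, `⟪u[v,f](x), ∇Q(x)⟫ = v_r ∂ᵣQ̃ + v_z ∂_zQ̃`, `Q̃ = Q(·,0,·)`
  (`= 0` where `v = 0`, `inner_swirlField_gradient_eq_zero`, without differentiability);
* `IsNSIStructure.laplacian_swirlField_of_notMem`, `….inner_swirlField_laplacian_nonneg` —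
  **(3.29)**: off `supp v`, `Δu[v,f] = (Lf) φ̂` and `u[v,f]·Δu[v,f] = f Lf ≥ 0` on `R({φ < 1})`
  (at points of `Ū ∖ U` by continuity of `Lf`, which is `> 0` on `U ∖ {φ = 1}`).

## References

* W. S. Ożański, arXiv:1709.00602v4, §3.3 (Lemma 3.1 (ii), (3.15)–(3.17)), §3.4 ((3.29)–(3.31)),
  §4.2 ((4.24), (4.32), (4.35)). [`Ozanski2017NSISingular`] (Held plain-text rendering:
  "Lemma 3", "Definition 5".)
-/

noncomputable section

open MeasureTheory Set Function Filter Topology TopologicalSpace WithLp Metric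
open scoped ENNReal InnerProductSpace RealInnerProductSpace ContDiff Laplacian

namespace Literature.Barriers.NavierStokesRegularity

open Literature.Analysis.FluidPDE

variable {v : ℝ × ℝ → ℝ × ℝ} {f φ : ℝ × ℝ → ℝ} {U : Set (ℝ × ℝ)}

/-! ### Leibniz rule for `G · Lx` with `L` linear -/

/-- The gradient in an orthonormal frame: `∇G(x) = Σᵢ (∂ᵢG) bᵢ`. [folklore] -/
theorem gradient_eq_sum_fderiv {ι : Type*} [Fintype ι]
    (b : OrthonormalBasis ι ℝ (EuclideanSpace ℝ (Fin 3))) (G : EuclideanSpace ℝ (Fin 3) → ℝ)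
    (x : EuclideanSpace ℝ (Fin 3)) : gradient G x = ∑ i, fderiv ℝ G x (b i) • b i := by
  conv_lhs => rw [← b.sum_repr' (gradient G x)]
  refine Finset.sum_congr rfl fun i _ => ?_
  rw [real_inner_comm, gradient, InnerProductSpace.toDual_symm_apply]

/-- **Leibniz rule for the Laplacian of a scalar times a linear field**: for `G ∈ C²` and a
continuous linear `L`, `Δ(G · Lx)(x) = (ΔG)(x) · Lx + 2 L(∇G(x))` (the second derivative of `L`
vanishes). [folklore] -/
theorem laplacian_smul_clm {G : EuclideanSpace ℝ (Fin 3) → ℝ} (hG : ContDiff ℝ 2 G)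
    (L : EuclideanSpace ℝ (Fin 3) →L[ℝ] EuclideanSpace ℝ (Fin 3)) (x : EuclideanSpace ℝ (Fin 3)) :
    (Δ fun w => G w • L w) x = (Δ G) x • L x + (2 : ℝ) • L (gradient G x) := by
  set b := EuclideanSpace.basisFun (Fin 3) ℝ with hb
  have hG1 : ContDiff ℝ 1 G := hG.of_le one_le_two
  have hGd : ∀ w, DifferentiableAt ℝ G w := fun w => hG1.differentiable one_ne_zero w
  have hGi : ∀ e, ContDiff ℝ 1 fun w => fderiv ℝ G w e := fun e =>
    (hG.fderiv_right (m := 1) le_rfl).clm_apply contDiff_const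
  have hGid : ∀ e w, DifferentiableAt ℝ (fun w => fderiv ℝ G w e) w := fun e w =>
    (hGi e).differentiable one_ne_zero w
  have hLd : ∀ w, DifferentiableAt ℝ (⇑L) w := fun w => L.differentiableAt
  -- first derivatives of the product
  have h1 : ∀ e, (fun w => fderiv ℝ (fun w => G w • L w) w e) =
      fun w => fderiv ℝ G w e • L w + G w • L e := fun e => by
    funext w
    rw [fderiv_fun_smul (hGd w) (hLd w), L.fderiv]
    simp only [_root_.add_apply, _root_.FunLike.coe_smul, Pi.smul_apply,
      ContinuousLinearMap.smulRight_apply]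
    rw [add_comm]
  rw [laplacian_eq_sum_fderiv_fderiv b (v := fun w => G w • L w) (hG.smul L.contDiff) x,
    laplacian_eq_sum_fderiv_fderiv b hG x,
    gradient_eq_sum_fderiv b G x, map_sum, Finset.smul_sum, Finset.sum_smul,
    ← Finset.sum_add_distrib]
  refine Finset.sum_congr rfl fun i _ => ?_
  rw [h1 (b i)]
  have hA : DifferentiableAt ℝ (fun w => fderiv ℝ G w (b i) • L w) x := (hGid _ x).smul (hLd x)
  have hB : DifferentiableAt ℝ (fun w => G w • L (b i)) x := (hGd x).smul (differentiableAt_const _)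
  rw [fderiv_fun_add hA hB, fderiv_fun_smul (hGid _ x) (hLd x), fderiv_fun_smul (hGd x)
    (differentiableAt_const _), L.fderiv, fderiv_fun_const]
  simp only [_root_.add_apply, _root_.FunLike.coe_smul, Pi.smul_apply,
    ContinuousLinearMap.smulRight_apply, map_smul, Pi.zero_apply]
  simp [two_smul]
  abel

/-! ### The meridian embedding and planar partial derivatives -/

/-- The meridian embedding `(r,z) ↦ (r,0,z)` as a continuous linear map. [folklore] -/
theorem meridianPoint_eq_clm (q : ℝ × ℝ) :
    meridianPoint q =
      ((ContinuousLinearMap.fst ℝ ℝ ℝ).smulRight (EuclideanSpace.single (0 : Fin 3) (1 : ℝ)) +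
        (ContinuousLinearMap.snd ℝ ℝ ℝ).smulRight eZ) q := by
  ext i
  fin_cases i <;> simp [meridianPoint, eZ]

/-- The derivative of the meridian embedding. [folklore] -/
theorem hasFDerivAt_meridianPoint (q : ℝ × ℝ) :
    HasFDerivAt meridianPoint
      ((ContinuousLinearMap.fst ℝ ℝ ℝ).smulRight (EuclideanSpace.single (0 : Fin 3) (1 : ℝ)) +
        (ContinuousLinearMap.snd ℝ ℝ ℝ).smulRight eZ) q := by
  rw [show meridianPoint = ⇑((ContinuousLinearMap.fst ℝ ℝ ℝ).smulRight
      (EuclideanSpace.single (0 : Fin 3) (1 : ℝ)) + (ContinuousLinearMap.snd ℝ ℝ ℝ).smulRight eZ)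
    from funext meridianPoint_eq_clm]
  exact ContinuousLinearMap.hasFDerivAt _

/-- **Radial planar derivative of a restriction**: `∂ᵣ(H(·,0,·))(q) = ∂₀H(q₁,0,q₂)`. [folklore] -/
theorem derivR_comp_meridianPoint {F : Type*} [NormedAddCommGroup F] [NormedSpace ℝ F]
    {H : EuclideanSpace ℝ (Fin 3) → F} {q : ℝ × ℝ} (hH : DifferentiableAt ℝ H (meridianPoint q)) :
    derivR (fun q' => H (meridianPoint q')) q =
      fderiv ℝ H (meridianPoint q) (EuclideanSpace.single (0 : Fin 3) (1 : ℝ)) := by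
  rw [derivR, show (fun q' => H (meridianPoint q')) = H ∘ meridianPoint from rfl,
    fderiv_comp q hH (hasFDerivAt_meridianPoint q).differentiableAt,
    (hasFDerivAt_meridianPoint q).fderiv]
  simp

/-- **Axial planar derivative of a restriction**: `∂_z(H(·,0,·))(q) = ∂₂H(q₁,0,q₂)`. [folklore] -/
theorem derivZ_comp_meridianPoint {F : Type*} [NormedAddCommGroup F] [NormedSpace ℝ F]
    {H : EuclideanSpace ℝ (Fin 3) → F} {q : ℝ × ℝ} (hH : DifferentiableAt ℝ H (meridianPoint q)) :
    derivZ (fun q' => H (meridianPoint q')) q = fderiv ℝ H (meridianPoint q) eZ := by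
  rw [derivZ, show (fun q' => H (meridianPoint q')) = H ∘ meridianPoint from rfl,
    fderiv_comp q hH (hasFDerivAt_meridianPoint q).differentiableAt,
    (hasFDerivAt_meridianPoint q).fderiv]
  simp

/-- Second radial planar derivative of a restriction of a `C²` function:
`∂ᵣ∂ᵣ(G(·,0,·))(q) = ∂₀∂₀G(q₁,0,q₂)`. [folklore] -/
theorem derivR_derivR_comp_meridianPoint {G : EuclideanSpace ℝ (Fin 3) → ℝ} (hG : ContDiff ℝ 2 G)
    (q : ℝ × ℝ) :
    derivR (derivR fun q' => G (meridianPoint q')) q =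
      fderiv ℝ (fun w => fderiv ℝ G w (EuclideanSpace.single (0 : Fin 3) (1 : ℝ)))
        (meridianPoint q) (EuclideanSpace.single (0 : Fin 3) (1 : ℝ)) := by
  have hGd : Differentiable ℝ G := hG.differentiable two_ne_zero
  have h1 : (derivR fun q' => G (meridianPoint q')) =
      fun q' => fderiv ℝ G (meridianPoint q') (EuclideanSpace.single (0 : Fin 3) (1 : ℝ)) :=
    funext fun q' => derivR_comp_meridianPoint (hGd _)
  rw [h1]
  exact derivR_comp_meridianPoint
    ((((hG.fderiv_right (m := 1) le_rfl).clm_apply contDiff_const).differentiable one_ne_zero) _)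

/-- Second axial planar derivative of a restriction of a `C²` function:
`∂_z∂_z(G(·,0,·))(q) = ∂₂∂₂G(q₁,0,q₂)`. [folklore] -/
theorem derivZ_derivZ_comp_meridianPoint {G : EuclideanSpace ℝ (Fin 3) → ℝ} (hG : ContDiff ℝ 2 G)
    (q : ℝ × ℝ) :
    derivZ (derivZ fun q' => G (meridianPoint q')) q =
      fderiv ℝ (fun w => fderiv ℝ G w eZ) (meridianPoint q) eZ := by
  have hGd : Differentiable ℝ G := hG.differentiable two_ne_zero
  have h1 : (derivZ fun q' => G (meridianPoint q')) = fun q' => fderiv ℝ G (meridianPoint q') eZ :=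
    funext fun q' => derivZ_comp_meridianPoint (hGd _)
  rw [h1]
  exact derivZ_comp_meridianPoint
    ((((hG.fderiv_right (m := 1) le_rfl).clm_apply contDiff_const).differentiable one_ne_zero) _)

/-! ### The cylindrical Laplacian of an axisymmetric scalar -/

/-- The Laplacian of an axisymmetric scalar is axisymmetric; in particular its value at `x`
equals its value at the meridian representative `(r, 0, z)` of `x`. [folklore] -/
theorem
    _root_.Literature.Analysis.FluidPDE.IsAxisymmetricScalar.laplacian_eq_laplacian_meridianPoint
    {G : EuclideanSpace ℝ (Fin 3) → ℝ} (hax : IsAxisymmetricScalar G)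
    (x : EuclideanSpace ℝ (Fin 3)) :
    (Δ G) x = (Δ G) (meridianPoint (meridian x)) := by
  set θ : ℝ := Complex.arg ⟨x 0, x 1⟩ with hθ
  have hxy : rotZ θ (meridianPoint (meridian x)) = x := rotZ_arg_meridianPoint x
  have hcomp : (fun w => G ((rotZLIE θ).symm.symm w)) = G := by
    funext w
    simp only [LinearIsometryEquiv.symm_symm, rotZLIE_apply]
    exact hax θ w
  have key :=
    laplacian_comp_linearIsometryEquiv_symm (rotZLIE θ).symm G (meridianPoint (meridian x))
  rw [hcomp] at key
  rw [key]
  simp only [LinearIsometryEquiv.symm_symm, rotZLIE_apply, hxy]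

/-- **The cylindrical Laplacian of an axisymmetric `C²` scalar** off the axis:
`ΔG(x) = ∂ᵣ∂ᵣg(q) + r⁻¹ ∂ᵣg(q) + ∂_z∂_zg(q)`, `q = (r,z) = meridian x`, `g = G(·,0,·)` the meridian
profile (the classical `Δ = ∂ᵣᵣ + r⁻¹∂ᵣ + r⁻²∂_θθ + ∂_zz` with `∂_θ G = 0`; here: rotate to the
meridian plane, where `ΔG = ∂₀₀G + ∂₁₁G + ∂₂₂G` and `x₀ ∂₁₁G = ∂₀G`). [folklore] -/
theorem _root_.Literature.Analysis.FluidPDE.IsAxisymmetricScalar.laplacian_eq_planar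
    {G : EuclideanSpace ℝ (Fin 3) → ℝ}
    (hax : IsAxisymmetricScalar G) (hG : ContDiff ℝ 2 G) {x : EuclideanSpace ℝ (Fin 3)}
    (hx : cylRadius x ≠ 0) :
    (Δ G) x = derivR (derivR fun q => G (meridianPoint q)) (meridian x) +
      (cylRadius x)⁻¹ * derivR (fun q => G (meridianPoint q)) (meridian x) +
        derivZ (derivZ fun q => G (meridianPoint q)) (meridian x) := by
  set y := meridianPoint (meridian x) with hy
  have hy1 : y 1 = 0 := rfl
  have hy0 : y 0 = cylRadius x := rfl
  rw [hax.laplacian_eq_laplacian_meridianPoint x, ← hy,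
    laplacian_eq_sum_fderiv_fderiv (EuclideanSpace.basisFun (Fin 3) ℝ) hG y, Fin.sum_univ_three]
  simp only [EuclideanSpace.basisFun_apply]
  have hmid := hax.mul_fderiv_fderiv_single_one hG hy1
  rw [hy0] at hmid
  have h1 : fderiv ℝ (fun w => fderiv ℝ G w (EuclideanSpace.single 1 1)) y
      (EuclideanSpace.single 1 1) =
      (cylRadius x)⁻¹ * fderiv ℝ G y (EuclideanSpace.single 0 1) := by
    rw [← hmid, ← mul_assoc, inv_mul_cancel₀ hx, one_mul]
  rw [h1, derivR_derivR_comp_meridianPoint hG, derivZ_derivZ_comp_meridianPoint hG,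
    derivR_comp_meridianPoint (hG.differentiable two_ne_zero _), ← hy]
  rfl

/-- A lifted planar profile and its meridian restriction agree near every point of the open
half-plane: `(γ ∘ meridian)(r,0,z) = γ(r,z)` for `r ≥ 0`. [folklore] -/
theorem comp_meridian_meridianPoint_eventuallyEq {F : Type*} (γ : ℝ × ℝ → F) {q : ℝ × ℝ}
    (hq : 0 < q.1) :
    (fun q' : ℝ × ℝ => γ (meridian (meridianPoint q'))) =ᶠ[𝓝 q] γ := by
  filter_upwards [(isOpen_lt continuous_const continuous_fst).mem_nhds hq] with q' hq'
  rw [meridian_meridianPoint (le_of_lt hq')]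

/-- First planar derivatives of `(γ ∘ meridian)(·,0,·)` are those of `γ` in the open half-plane.
[folklore] -/
theorem derivR_comp_meridian_meridianPoint (γ : ℝ × ℝ → ℝ) {q : ℝ × ℝ} (hq : 0 < q.1) :
    derivR (fun q' => γ (meridian (meridianPoint q'))) q = derivR γ q := by
  rw [derivR, derivR, (comp_meridian_meridianPoint_eventuallyEq γ hq).fderiv_eq]

/-- As `derivR_comp_meridian_meridianPoint`, for `∂_z`. [folklore] -/
theorem derivZ_comp_meridian_meridianPoint (γ : ℝ × ℝ → ℝ) {q : ℝ × ℝ} (hq : 0 < q.1) :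
    derivZ (fun q' => γ (meridian (meridianPoint q'))) q = derivZ γ q := by
  rw [derivZ, derivZ, (comp_meridian_meridianPoint_eventuallyEq γ hq).fderiv_eq]

/-- Second radial derivatives agree as well. [folklore] -/
theorem derivR_derivR_comp_meridian_meridianPoint (γ : ℝ × ℝ → ℝ) {q : ℝ × ℝ} (hq : 0 < q.1) :
    derivR (derivR fun q' => γ (meridian (meridianPoint q'))) q = derivR (derivR γ) q := by
  have h : (derivR fun q' => γ (meridian (meridianPoint q'))) =ᶠ[𝓝 q] derivR γ := by
    filter_upwards [(isOpen_lt continuous_const continuous_fst).mem_nhds hq] with q' hq'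
    exact derivR_comp_meridian_meridianPoint γ hq'
  rw [derivR, derivR, h.fderiv_eq]

/-- Second axial derivatives agree as well. [folklore] -/
theorem derivZ_derivZ_comp_meridian_meridianPoint (γ : ℝ × ℝ → ℝ) {q : ℝ × ℝ} (hq : 0 < q.1) :
    derivZ (derivZ fun q' => γ (meridian (meridianPoint q'))) q = derivZ (derivZ γ) q := by
  have h : (derivZ fun q' => γ (meridian (meridianPoint q'))) =ᶠ[𝓝 q] derivZ γ := by
    filter_upwards [(isOpen_lt continuous_const continuous_fst).mem_nhds hq] with q' hq'
    exact derivZ_comp_meridian_meridianPoint γ hq'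
  rw [derivZ, derivZ, h.fderiv_eq]

/-- **The cylindrical Laplacian of a lifted profile**: for a planar `γ` whose lift
`γ ∘ meridian` is `C²` on `ℝ³`, off the axis
`Δ(γ ∘ meridian)(x) = ∂ᵣ∂ᵣγ(q) + r⁻¹∂ᵣγ(q) + ∂_z∂_zγ(q)`, `q = meridian x`. [folklore] -/
theorem laplacian_comp_meridian {γ : ℝ × ℝ → ℝ}
    (hγ : ContDiff ℝ 2 fun w : EuclideanSpace ℝ (Fin 3) => γ (meridian w))
    {x : EuclideanSpace ℝ (Fin 3)} (hx : cylRadius x ≠ 0) :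
    (Δ fun w : EuclideanSpace ℝ (Fin 3) => γ (meridian w)) x =
      derivR (derivR γ) (meridian x) + (cylRadius x)⁻¹ * derivR γ (meridian x) +
        derivZ (derivZ γ) (meridian x) := by
  have hax : IsAxisymmetricScalar fun w : EuclideanSpace ℝ (Fin 3) => γ (meridian w) :=
    fun θ w => by simp only [meridian_rotZ]
  have hq : 0 < (meridian x).1 := lt_of_le_of_ne (cylRadius_nonneg x) (Ne.symm hx)
  rw [hax.laplacian_eq_planar hγ hx, derivR_derivR_comp_meridian_meridianPoint γ hq,
    derivR_comp_meridian_meridianPoint γ hq, derivZ_derivZ_comp_meridian_meridianPoint γ hq]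

/-! ### Gradient of a lifted profile; Lemma 3.1 (ii) -/

/-- **`∇(γ ∘ meridian)(x) = ∂ᵣγ(q) ρ̂(x) + ∂_zγ(q) x̂_axis`** off the axis. [folklore] -/
theorem gradient_comp_meridian {γ : ℝ × ℝ → ℝ} {x : EuclideanSpace ℝ (Fin 3)} (hx : cylRadius x ≠ 0)
    (hγ : DifferentiableAt ℝ γ (meridian x)) :
    gradient (fun w => γ (meridian w)) x =
      derivR γ (meridian x) • eR x + derivZ γ (meridian x) • eZ := by
  refine ext_inner_right ℝ fun w => ?_
  have hsplit : ((⟪eR x, w⟫, w 2) : ℝ × ℝ) =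
      ⟪eR x, w⟫ • ((1 : ℝ), (0 : ℝ)) + (w 2) • ((0 : ℝ), (1 : ℝ)) := by
    ext <;> simp
  rw [gradient, InnerProductSpace.toDual_symm_apply, fderiv_comp_meridian_apply hx hγ, hsplit,
    map_add, map_smul, map_smul, inner_add_left, real_inner_smul_left, real_inner_smul_left, derivR,
    derivZ, smul_eq_mul, smul_eq_mul]
  rw [eZ, EuclideanSpace.inner_single_left]
  simp
  ring

/-- `J ρ̂ = φ̂` and `J x̂_axis = 0`: the rotation generator turns the radial frame vector into
the angular one. [folklore] -/
theorem rotGen_eR (x : EuclideanSpace ℝ (Fin 3)) : rotGen (eR x) = eTheta x := by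
  ext i
  fin_cases i <;> simp [rotGen, eR, eTheta]

/-- `J x̂_axis = 0`. [folklore] -/
theorem rotGen_eZ : rotGen eZ = (0 : EuclideanSpace ℝ (Fin 3)) := by
  ext i
  fin_cases i <;> simp [rotGen, eZ]

/-- The swirl field of a profile as a profile times the linear field `J`:
`f(q) φ̂(x) = (f/r)(q) Jx`. [folklore] -/
theorem swirl_eq_smul_rotGen (f : ℝ × ℝ → ℝ) :
    (fun w : EuclideanSpace ℝ (Fin 3) => f (meridian w) • eTheta w) =
      fun w => (f (meridian w) * (meridian w).1⁻¹) • rotGen w := by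
  funext w
  simp only [eTheta, rotGen, smul_smul, meridian_apply, mul_comm]

/-- The planar identity behind Lemma 3.1 (ii): with `γ = f/r`,
`r ∂ᵣ∂ᵣγ + 3 ∂ᵣγ + r ∂_z∂_zγ = Lf` in the open half-plane, for `f ∈ C²`. [folklore] -/
theorem opL_eq_of_div_fst {f : ℝ × ℝ → ℝ} (hf : ContDiff ℝ 2 f) {q : ℝ × ℝ} (hq : 0 < q.1) :
    q.1 * derivR (derivR fun q' => f q' * q'.1⁻¹) q + 3 * derivR (fun q' => f q' * q'.1⁻¹) q +
        q.1 * derivZ (derivZ fun q' => f q' * q'.1⁻¹) q = opL f q := by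
  have hq0 : q.1 ≠ 0 := hq.ne'
  have hfd : Differentiable ℝ f := hf.differentiable two_ne_zero
  have hdf : ContDiff ℝ 1 (fderiv ℝ f) := hf.fderiv_right (by norm_num)
  have hR1 : ContDiff ℝ 1 (derivR f) := hdf.clm_apply contDiff_const
  have hZ1 : ContDiff ℝ 1 (derivZ f) := hdf.clm_apply contDiff_const
  -- the inverse radius and its planar derivatives
  set ι : ℝ × ℝ → ℝ := fun q' => q'.1⁻¹ with hι
  have hO : IsOpen {q' : ℝ × ℝ | 0 < q'.1} := isOpen_lt continuous_const continuous_fst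
  have hιd : ∀ q' : ℝ × ℝ, q'.1 ≠ 0 → HasFDerivAt ι
      ((ContinuousLinearMap.smulRight (1 : ℝ →L[ℝ] ℝ) (-(q'.1 ^ 2)⁻¹)).comp
        (ContinuousLinearMap.fst ℝ ℝ ℝ)) q' := fun q' hq' =>
    (hasFDerivAt_inv hq').comp q' hasFDerivAt_fst
  have hιR : ∀ q' : ℝ × ℝ, q'.1 ≠ 0 → derivR ι q' = -(q'.1 ^ 2)⁻¹ := fun q' hq' => by
    rw [derivR, (hιd q' hq').fderiv]; simp
  have hιZ : ∀ q' : ℝ × ℝ, q'.1 ≠ 0 → derivZ ι q' = 0 := fun q' hq' => by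
    rw [derivZ, (hιd q' hq').fderiv]; simp
  -- first derivatives of `γ = f ι` on the open half-plane
  have hγR : ∀ q' : ℝ × ℝ, q'.1 ≠ 0 →
      derivR (fun q'' => f q'' * ι q'') q' = derivR f q' * ι q' - f q' * (q'.1 ^ 2)⁻¹ := by
    intro q' hq'
    rw [derivR, fderiv_fun_mul (hfd q') (hιd q' hq').differentiableAt]
    simp only [_root_.add_apply, _root_.FunLike.coe_smul, Pi.smul_apply,
      smul_eq_mul]
    rw [show fderiv ℝ ι q' (1, 0) = derivR ι q' from rfl, hιR q' hq', derivR]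
    ring
  have hγZ : ∀ q' : ℝ × ℝ, q'.1 ≠ 0 →
      derivZ (fun q'' => f q'' * ι q'') q' = derivZ f q' * ι q' := by
    intro q' hq'
    rw [derivZ, fderiv_fun_mul (hfd q') (hιd q' hq').differentiableAt]
    simp only [_root_.add_apply, _root_.FunLike.coe_smul, Pi.smul_apply,
      smul_eq_mul]
    rw [show fderiv ℝ ι q' (0, 1) = derivZ ι q' from rfl, hιZ q' hq', derivZ]
    ring
  -- as functions near `q`
  have eR : (derivR fun q'' => f q'' * ι q'') =ᶠ[𝓝 q]
      fun q' => derivR f q' * ι q' - f q' * (ι q') ^ 2 := by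
    filter_upwards [hO.mem_nhds hq] with q' hq'
    rw [hγR q' (ne_of_gt hq')]
    simp [hι, inv_pow]
  have eZ' : (derivZ fun q'' => f q'' * ι q'') =ᶠ[𝓝 q] fun q' => derivZ f q' * ι q' := by
    filter_upwards [hO.mem_nhds hq] with q' hq'
    rw [hγZ q' (ne_of_gt hq')]
  -- second derivatives
  have hιdq : DifferentiableAt ℝ ι q := (hιd q hq0).differentiableAt
  have hR1d : DifferentiableAt ℝ (derivR f) q := hR1.differentiable one_ne_zero q
  have hZ1d : DifferentiableAt ℝ (derivZ f) q := hZ1.differentiable one_ne_zero q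
  have hRR : derivR (derivR fun q'' => f q'' * ι q'') q =
      derivR (derivR f) q * ι q - 2 * derivR f q * (q.1 ^ 2)⁻¹ + 2 * f q * (q.1 ^ 3)⁻¹ := by
    rw [derivR, eR.fderiv_eq, fderiv_fun_sub (hR1d.fun_mul hιdq) ((hfd q).fun_mul (hιdq.fun_pow 2)),
      fderiv_fun_mul hR1d hιdq, fderiv_fun_mul (hfd q) (hιdq.fun_pow 2),
      show (fun q' => ι q' ^ 2) = fun q' => ι q' * ι q' from funext fun _ => sq _,
      fderiv_fun_mul hιdq hιdq]
    simp only [_root_.sub_apply, _root_.add_apply,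
      _root_.FunLike.coe_smul, Pi.smul_apply, smul_eq_mul]
    rw [show fderiv ℝ ι q (1, 0) = derivR ι q from rfl, hιR q hq0,
      show fderiv ℝ (derivR f) q (1, 0) = derivR (derivR f) q from rfl,
      show fderiv ℝ f q (1, 0) = derivR f q from rfl]
    simp only [hι]
    field_simp
    ring
  have hZZ : derivZ (derivZ fun q'' => f q'' * ι q'') q = derivZ (derivZ f) q * ι q := by
    rw [derivZ, eZ'.fderiv_eq, fderiv_fun_mul hZ1d hιdq]
    simp only [_root_.add_apply, _root_.FunLike.coe_smul, Pi.smul_apply,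
      smul_eq_mul]
    rw [show fderiv ℝ ι q (0, 1) = derivZ ι q from rfl, hιZ q hq0,
      show fderiv ℝ (derivZ f) q (0, 1) = derivZ (derivZ f) q from rfl]
    ring
  rw [hRR, hZZ, hγR q hq0, opL]
  simp only [hι]
  field_simp
  ring

/-- **Lemma 3.1 (ii): the Laplacian of the swirl field of a profile** — off the axis,
`Δ(f(q) φ̂)(x) = (Lf)(q) φ̂(x)`, `Lf = ∂ᵣ∂ᵣf + ∂_z∂_zf + r⁻¹∂ᵣf - f/r²` (Ożański (3.15)–(3.16):
`Δu[0,f] = Lf φ̂`). Hypotheses: `f ∈ C²`, and the lifted profile `(f/r) ∘ meridian` is `C²` on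
`ℝ³` (true for the profiles of structures, which vanish near the axis).
[cite: Ozanski2017NSISingular, Lemma 3.1 (ii)] -/
theorem laplacian_swirl {f : ℝ × ℝ → ℝ} (hf : ContDiff ℝ 2 f)
    (hγ : ContDiff ℝ 2 fun w : EuclideanSpace ℝ (Fin 3) => f (meridian w) * (meridian w).1⁻¹)
    {x : EuclideanSpace ℝ (Fin 3)} (hx : cylRadius x ≠ 0) :
    (Δ fun w : EuclideanSpace ℝ (Fin 3) => f (meridian w) • eTheta w) x =
      opL f (meridian x) • eTheta x := by
  have hq : 0 < (meridian x).1 := lt_of_le_of_ne (cylRadius_nonneg x) (Ne.symm hx)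
  have hγ' : ContDiff ℝ 2 fun w : EuclideanSpace ℝ (Fin 3) =>
      (fun q : ℝ × ℝ => f q * q.1⁻¹) (meridian w) := hγ
  have hγd : DifferentiableAt ℝ (fun q : ℝ × ℝ => f q * q.1⁻¹) (meridian x) :=
    ((hf.differentiable two_ne_zero) _).mul (differentiableAt_fst.inv hx)
  rw [swirl_eq_smul_rotGen, show (fun w : EuclideanSpace ℝ (Fin 3) =>
      (f (meridian w) * (meridian w).1⁻¹) • rotGen w) =
      fun w => (f (meridian w) * (meridian w).1⁻¹) • rotGenL w from rfl,
    laplacian_smul_clm hγ' rotGenL x,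
    laplacian_comp_meridian (γ := fun q : ℝ × ℝ => f q * q.1⁻¹) hγ' hx,
    gradient_comp_meridian (γ := fun q : ℝ × ℝ => f q * q.1⁻¹) hx hγd]
  simp only [rotGenL_apply, map_add, map_smul, rotGen_eR, rotGen_eZ,
    smul_zero, add_zero, rotGen_eq_cylRadius_smul_eTheta hx, smul_smul, ← add_smul]
  congr 1
  rw [← opL_eq_of_div_fst hf hq]
  simp only [meridian_apply]
  field_simp
  ring

/-- **(3.31): `⟪f φ̂, Δ(f φ̂)⟫ = f Lf`** off the axis.
[cite: Ozanski2017NSISingular, §3.4 (3.31)] -/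
theorem inner_swirl_laplacian_swirl {f : ℝ × ℝ → ℝ} (hf : ContDiff ℝ 2 f)
    (hγ : ContDiff ℝ 2 fun w : EuclideanSpace ℝ (Fin 3) => f (meridian w) * (meridian w).1⁻¹)
    {x : EuclideanSpace ℝ (Fin 3)} (hx : cylRadius x ≠ 0) :
    ⟪f (meridian x) • eTheta x,
      (Δ fun w : EuclideanSpace ℝ (Fin 3) => f (meridian w) • eTheta w) x⟫ =
      f (meridian x) * opL f (meridian x) := by
  have hn : ‖eTheta x‖ ^ 2 = 1 := by simpa using norm_sq_frame hx 0 0 1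
  rw [laplacian_swirl hf hγ hx, real_inner_smul_left, real_inner_smul_right,
    real_inner_self_eq_norm_sq, hn, mul_one]

/-! ### (3.30): pairing `u[v,f]` with gradients of axisymmetric scalars -/

/-- `⟪φ̂, ρ̂⟫ = 0`. [folklore] -/
theorem inner_eTheta_eR (x : EuclideanSpace ℝ (Fin 3)) : ⟪eTheta x, eR x⟫ = 0 := by
  have : ⟪rotGen x, (toLp 2 ![x 0, x 1, 0] : EuclideanSpace ℝ (Fin 3))⟫ = 0 := by
    simp [rotGen, PiLp.inner_apply, Fin.sum_univ_three]
    ring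
  have h : eTheta x = (cylRadius x)⁻¹ • rotGen x := rfl
  rw [h, eR, inner_smul_left, inner_smul_right, this, mul_zero, mul_zero]

/-- `⟪φ̂, x̂_axis⟫ = 0`. [folklore] -/
theorem inner_eTheta_eZ (x : EuclideanSpace ℝ (Fin 3)) : ⟪eTheta x, eZ⟫ = 0 := by
  rw [eZ, EuclideanSpace.inner_single_right]
  simp [eTheta]

/-- An axisymmetric scalar differentiable at `x` is differentiable at the meridian
representative `(r,0,z)` of `x` (composition with a rotation). [folklore] -/
theorem _root_.Literature.Analysis.FluidPDE.IsAxisymmetricScalar.differentiableAt_meridianPoint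
    {Q : EuclideanSpace ℝ (Fin 3) → ℝ} (hax : IsAxisymmetricScalar Q) {x : EuclideanSpace ℝ (Fin 3)}
    (hQ : DifferentiableAt ℝ Q x) : DifferentiableAt ℝ Q (meridianPoint (meridian x)) := by
  set θ : ℝ := Complex.arg ⟨x 0, x 1⟩
  have hxy : rotZ θ (meridianPoint (meridian x)) = x := rotZ_arg_meridianPoint x
  have hcomp : (fun w => Q (rotZ θ w)) = Q := funext fun w => hax θ w
  have hQ' : DifferentiableAt ℝ Q (rotZ θ (meridianPoint (meridian x))) := by
    rw [hxy]; exact hQ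
  have h1 : DifferentiableAt ℝ (fun w => Q (rotZ θ w)) (meridianPoint (meridian x)) :=
    hQ'.comp _ (rotZLIE θ).toContinuousLinearEquiv.differentiableAt
  rwa [hcomp] at h1

/-- **(3.30), quantitatively: pairing `u[v,f]` with the gradient of an axisymmetric scalar.**
For `Q` axisymmetric and differentiable at `x` (off the axis),
`⟪u[v,f](x), ∇Q(x)⟫ = v_r(q) ∂ᵣQ̃(q) + v_z(q) ∂_zQ̃(q)`, `Q̃ = Q(·,0,·)`, `q = meridian x`: the
swirl component is orthogonal to `∇Q` (Ożański (3.30): `u[v,f]·∇q = 0` where `v = 0`; (4.24)/(4.35):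
the 3D pairing equals the planar one).
[cite: Ozanski2017NSISingular, §3.4 (3.30) and §4.2 (4.35)] -/
theorem inner_swirlField_gradient {Q : EuclideanSpace ℝ (Fin 3) → ℝ} (hax : IsAxisymmetricScalar Q)
    (v : ℝ × ℝ → ℝ × ℝ) (f : ℝ × ℝ → ℝ) {x : EuclideanSpace ℝ (Fin 3)} (hx : cylRadius x ≠ 0)
    (hQ : DifferentiableAt ℝ Q x) :
    ⟪swirlField v f x, gradient Q x⟫ =
      (v (meridian x)).1 * derivR (fun q => Q (meridianPoint q)) (meridian x) +
        (v (meridian x)).2 * derivZ (fun q => Q (meridianPoint q)) (meridian x) := by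
  have hQm : DifferentiableAt ℝ (fun q => Q (meridianPoint q)) (meridian x) :=
    (hax.differentiableAt_meridianPoint hQ).comp _ (hasFDerivAt_meridianPoint _).differentiableAt
  have hrep : Q = fun w => (fun q => Q (meridianPoint q)) (meridian w) :=
    funext hax.eq_comp_meridian
  conv_lhs => rw [hrep]
  rw [gradient_comp_meridian (γ := fun q => Q (meridianPoint q)) hx hQm, swirlField, inner_add_left,
    inner_add_left, inner_add_right, inner_add_right, inner_add_right]
  simp only [real_inner_smul_left, real_inner_smul_right, inner_eR_self hx,
    inner_eTheta_eR, inner_eTheta_eZ, real_inner_comm (eZ : EuclideanSpace ℝ (Fin 3)) (eR x)]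
  rw [eZ, EuclideanSpace.inner_single_left]
  simp
  ring

/-- **(3.30): `u[v,f]·∇Q = 0` off `supp v`** for every axisymmetric scalar `Q` (no
differentiability needed: where `Q` is not differentiable the gradient is the junk `0`; on the
axis the frame vectors `ρ̂, φ̂` vanish). [cite: Ozanski2017NSISingular, §3.4 (3.30)] -/
theorem inner_swirlField_gradient_eq_zero {Q : EuclideanSpace ℝ (Fin 3) → ℝ}
    (hax : IsAxisymmetricScalar Q) (v : ℝ × ℝ → ℝ × ℝ) (f : ℝ × ℝ → ℝ)
    {x : EuclideanSpace ℝ (Fin 3)} (hv : v (meridian x) = 0) :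
    ⟪swirlField v f x, gradient Q x⟫ = 0 := by
  by_cases hx : cylRadius x = 0
  · have hE : eTheta x = 0 := by simp [eTheta, hx]
    have hR : eR x = 0 := by simp [eR, hx]
    have hv' : v (cylRadius x, x 2) = 0 := hv
    simp [swirlField, hv', hE, hR]
  · by_cases hQ : DifferentiableAt ℝ Q x
    · rw [inner_swirlField_gradient hax v f hx hQ, hv]
      simp
    · rw [gradient, fderiv_zero_of_not_differentiableAt hQ]
      simp

/-! ### (3.29) for a structure: `u·Δu = f Lf ≥ 0` on `R({φ < 1})` -/

/-- `Lf` is continuous on the open half-plane for `f ∈ C^∞`. [folklore] -/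
theorem continuousAt_opL {f : ℝ × ℝ → ℝ} (hf : ContDiff ℝ ∞ f) {q : ℝ × ℝ} (hq : q.1 ≠ 0) :
    ContinuousAt (opL f) q := by
  have hf3 : ContDiff ℝ 3 f := contDiff_infty.1 hf 3
  have hD1 : ContDiff ℝ 2 (fderiv ℝ f) := hf3.fderiv_right (m := 2) (by norm_num)
  have hR : ContDiff ℝ 2 (derivR f) := hD1.clm_apply contDiff_const
  have hZ : ContDiff ℝ 2 (derivZ f) := hD1.clm_apply contDiff_const
  have hRR : ContDiff ℝ 1 (derivR (derivR f)) :=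
    (hR.fderiv_right (m := 1) (by norm_num)).clm_apply contDiff_const
  have hZZ : ContDiff ℝ 1 (derivZ (derivZ f)) :=
    (hZ.fderiv_right (m := 1) (by norm_num)).clm_apply contDiff_const
  have e : opL f = fun q' => derivR (derivR f) q' + derivZ (derivZ f) q' + q'.1⁻¹ * derivR f q' -
      f q' / q'.1 ^ 2 := rfl
  rw [e]
  refine ((hRR.continuous.continuousAt.add hZZ.continuous.continuousAt).add
    ((continuousAt_fst.inv₀ hq).mul hR.continuous.continuousAt)).sub
    (hf.continuous.continuousAt.div (continuousAt_fst.pow 2) (pow_ne_zero 2 hq))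

namespace IsNSIStructure

/-- The lifted swirl profile `(f/r) ∘ meridian` of a structure is smooth on `ℝ³`. [folklore] -/
theorem contDiff_comp_meridian_div (h : IsNSIStructure U v f φ) :
    ContDiff ℝ ∞ fun w : EuclideanSpace ℝ (Fin 3) => f (meridian w) * (meridian w).1⁻¹ := by
  obtain ⟨r₀, hr₀, h0⟩ := h.exists_axis_margin'
  exact contDiff_comp_meridian_of_eq_zero (G := fun q => f q * q.1⁻¹)
    (contDiff_mul_inv_fst_of_eq_zero h.f_smooth hr₀ fun q hq => (h0 q hq).1) hr₀
    fun q hq => by simp [(h0 q hq).1]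

/-- Off `supp v` the field of a structure is locally the pure swirl `f φ̂`. [folklore] -/
theorem swirlField_eventuallyEq_swirl (h : IsNSIStructure U v f φ) {x : EuclideanSpace ℝ (Fin 3)}
    (hq : meridian x ∉ tsupport v) :
    swirlField v f =ᶠ[𝓝 x] fun w => f (meridian w) • eTheta w := by
  have hO : IsOpen ((tsupport v)ᶜ) := (isClosed_tsupport v).isOpen_compl
  filter_upwards [(hO.preimage continuous_meridian).mem_nhds hq] with w hw
  have hv0 : v (meridian w) = 0 := image_eq_zero_of_notMem_tsupport hw
  simp only [swirlField, hv0, Prod.fst_zero, Prod.snd_zero, zero_smul, zero_add]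
  rw [show ((0 : ℝ) ^ 2 + (0 : ℝ) ^ 2) = 0 by norm_num, sub_zero, Real.sqrt_sq (h.f_nonneg _)]

/-- **`Δu[v,f] = (Lf) φ̂` off `supp v`** (off the axis), by Lemma 3.1 (ii) and locality of `Δ`.
[cite: Ozanski2017NSISingular, Lemma 3.1 (ii) and §3.4 (3.31)] -/
theorem laplacian_swirlField_of_notMem (h : IsNSIStructure U v f φ) {x : EuclideanSpace ℝ (Fin 3)}
    (hx : cylRadius x ≠ 0) (hq : meridian x ∉ tsupport v) :
    (Δ (swirlField v f)) x = opL f (meridian x) • eTheta x := by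
  rw [(InnerProductSpace.laplacian_congr_nhds (h.swirlField_eventuallyEq_swirl hq)).self_of_nhds]
  exact laplacian_swirl (contDiff_infty.1 h.f_smooth 2)
    (contDiff_infty.1 h.contDiff_comp_meridian_div 2) hx

/-- **`Lf ≥ 0` on `Ū ∖ {φ = 1}`** (on `U ∖ {φ = 1}` by Definition 3.3; at the remaining points of
`Ū` by continuity of `Lf`, since `{φ = 1}` is closed).
[cite: Ozanski2017NSISingular, Definition 3.3] -/
theorem opL_nonneg_of_mem_closure (h : IsNSIStructure U v f φ) {q : ℝ × ℝ} (hq : q ∈ closure U)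
    (hφ : φ q ≠ 1) : 0 ≤ opL f q := by
  have hq1 : 0 < q.1 := h.closure_subset hq
  set N : Set (ℝ × ℝ) := {q' | φ q' = 1}ᶜ with hN
  have hNo : IsOpen N := (isClosed_eq h.φ_smooth.continuous continuous_const).isOpen_compl
  have hqN : N ∈ 𝓝 q := hNo.mem_nhds hφ
  -- `q` is in the closure of `U ∩ N`, where `Lf > 0`
  have hne : (𝓝[U ∩ N] q).NeBot := by
    rw [← mem_closure_iff_nhdsWithin_neBot, mem_closure_iff_nhds]
    intro W hW
    obtain ⟨q', hq'W, hq'U⟩ := mem_closure_iff_nhds.1 hq (W ∩ N) (inter_mem hW hqN)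
    exact ⟨q', hq'W.1, hq'U, hq'W.2⟩
  have hev : ∀ᶠ q' in 𝓝[U ∩ N] q, 0 < opL f q' :=
    eventually_mem_nhdsWithin.mono fun q' hq' => h.opL_pos q' hq'.1 hq'.2
  exact ge_of_tendsto ((continuousAt_opL h.f_smooth hq1.ne').tendsto.mono_left nhdsWithin_le_nhds)
    (hev.mono fun q' hq' => hq'.le)

/-- **(3.29): `u[v,f]·Δu[v,f] ≥ 0` on `R({φ < 1})`** for a structure `(v,f,φ)` on `U`
(there `v = 0`, `u = f φ̂`, `u·Δu = f Lf` by (3.31), and `f ≥ 0`, `Lf ≥ 0`).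
[cite: Ozanski2017NSISingular, §3.4 (3.29) and (3.31)] -/
theorem inner_swirlField_laplacian_nonneg (h : IsNSIStructure U v f φ)
    {x : EuclideanSpace ℝ (Fin 3)} (hφ : φ (meridian x) < 1) :
    0 ≤ ⟪swirlField v f x, (Δ (swirlField v f)) x⟫ := by
  by_cases hq : meridian x ∈ closure U
  · have hq1 : 0 < (meridian x).1 := h.closure_subset hq
    have hx : cylRadius x ≠ 0 := hq1.ne'
    have hqv : meridian x ∉ tsupport v := fun h' => hφ.ne (h.tsupport_v h')
    have hu : swirlField v f x = f (meridian x) • eTheta x :=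
      (h.swirlField_eventuallyEq_swirl hqv).self_of_nhds
    have hn : ‖eTheta x‖ ^ 2 = 1 := by simpa using norm_sq_frame hx 0 0 1
    rw [h.laplacian_swirlField_of_notMem hx hqv, hu, real_inner_smul_left, real_inner_smul_right,
      real_inner_self_eq_norm_sq, hn, mul_one]
    exact mul_nonneg (h.f_nonneg _) (h.opL_nonneg_of_mem_closure hq hφ.ne)
  · rw [h.swirlField_eq_zero hq, inner_zero_left]

/-- **(3.31) for a structure: `u[v,f]·Δu[v,f] = f Lf` at the points of `R(Ū)` off `R(supp v)`.**
[cite: Ozanski2017NSISingular, §3.4 (3.31)] -/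
theorem inner_swirlField_laplacian_eq (h : IsNSIStructure U v f φ) {x : EuclideanSpace ℝ (Fin 3)}
    (hx : cylRadius x ≠ 0) (hqv : meridian x ∉ tsupport v) :
    ⟪swirlField v f x, (Δ (swirlField v f)) x⟫ = f (meridian x) * opL f (meridian x) := by
  have hu : swirlField v f x = f (meridian x) • eTheta x :=
    (h.swirlField_eventuallyEq_swirl hqv).self_of_nhds
  have hn : ‖eTheta x‖ ^ 2 = 1 := by simpa using norm_sq_frame hx 0 0 1
  rw [h.laplacian_swirlField_of_notMem hx hqv, hu, real_inner_smul_left, real_inner_smul_right,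
    real_inner_self_eq_norm_sq, hn, mul_one]

end IsNSIStructure

end Literature.Barriers.NavierStokesRegularity
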